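import Summits.QuantumFields.BalabanUV.Beta.D1BFx.NeedleGhostBubble2Pointwise

/-!
# `BalabanUV.Beta.D1BFx.NeedleGhostBubble2PointwiseOpen` — road «BF-x», binder row D1, slot (K), END row `hGrp gN`, (N-2) «T₆-ii POINTWISE»:
# **THE FOUR-PLACEMENT BOUND OF THE TWO-NEEDLE GHOST BUBBLE `qA ⊗ qA` WITH THE MIXED TERMS' NEEDLE–LEG–NEEDLE CONTRACTIONS LEFT OPEN** (no leg sup:
# the diagonal placements through the SIGNED block sums as of record, the two mixed placements as `n⁴·(row-sum letter) × Σ_{z,t} |g z|·|K z t|·|g′ t|`)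

HONEST DEPENDENCY (cell records, verbatim): «continuum YM on T⁴ ⇐ BetaPertH ∧ nine spine estimates (0/9 proved); BetaPertH ⇐ (D1) ∧ (D4) ∧
CAP+tail; G-an2-4 gates asym, D1 and NE2/3/4.»  HONEST FRAMING (cell contract, verbatim): «discharging `BetaPertH` makes Bałaban's UV stability
UNCONDITIONAL — a real constructive-QFT result; it is NOT the continuum limit and NOT the Clay problem.»  THIS MODULE DISCHARGES NOTHING of the wall:
[folklore] FINITE bookkeeping BY NAME over the OWNER's closed form `NeedleGhostBubble2Pointwise.biBubble_qAntiAt_qAntiAt` (p258530) and M1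
`GhostNeedleRootedLetters.sum_B_const'`; holds for ANY two legs `A K : MKer 4 Unit` (no decay, no symmetry, no `Spr`).  No `def`, no `def … : Prop`, nothing
cited, 0 sorry.  0 wall binders (root-level hW ∕ hR-sockets ∕ hSX-socket ∕ D1Tel ∕ D1Rep — 0); (K) NOT closed; NOT D1, NOT `BetaPertH`, NOT continuum, NOT Clay.

ABSOLUTE RULE (cell charter, verbatim): «No internally-minted statement may enter as a cited fact. Every hypothesis is either kernel-proved in this
package or a verbatim quotation of a PUBLISHED theorem with page reference. The manuscript(s) under audit are NOT citable for their own disputed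
steps — they are the thing under adjudication; programme-internal (2001/route/tribunal) claims are never citable.»

WHY (an3-g65 SUPPLY S-an3-g65-1 «SUP-VS-MASS CENSUS» §3 h₆ — «keep the contraction OPEN in the pointwise half», ADOPTED by the OWNER d1-p2-g12 WORDS (2)
`CLAIMS.log` 2026-08-21T16:15:54Z «T₆-ii = `h₆_of_scaling₈` by an3's recipe VERBATIM … one pointwise four-placement lemma with T2∕T3's contractions left OPEN + one row
file; FIRST REFUSAL gan24-leaf-05»; this lineage's «MINE» T₆-ii).  The record's `abs_biBubble_qAntiAt_qAntiAt_le` closes the mixed terms T2∕T3 pointwise by the leg SUP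
(`n⁴·RA·SK`, `n⁴·SA·RK`), which costs the row exactly n⁴ (census §1–§2: the ONE sup placement of the three ghost needle rows).  Here T2's factor
`Σ_{z∈B} g z·(Σ_{t∈B′} K z t·g′ t)` and T3's `Σ_{x∈B′} (Σ_{t∈B} A x t·g t)·g′ x` are bounded only by their |·|-contractions, so that the ROW half can sum the running bond
over a block at a FIXED leg site (M7) before the leg's block-column mass (M10) is taken — the re-routing of leaf-04-g12's `NeedleGhostTadpoleRowMass8`.
CONTENT (notation of `NeedleGhostBubble2Pointwise`: `B := B(blk u)`, `B′ := B(blk u′)`, `g := qJetAt ρ n κ u (blk u)`, `g′ := qJetAt ρ n λ u′ (blk u′)`).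
* [folklore] **`abs_biBubble_qAntiAt_qAntiAt_le_open`**: under the four SIGNED-sum letters only (`RA`, `RK` rows; `CA`, `CK` columns),
  `|biBubble A (qA_u) K (qA_{u′})| ≤ (RA·RK + CA·CK)·(Σ_{z∈B}|g z|)·(Σ_{x∈B′}|g′ x|) + n⁴·RA·Σ_{z∈B}Σ_{t∈B′}|g z|·(|K z t|·|g′ t|) + n⁴·RK·Σ_{x∈B′}Σ_{t∈B}|g′ x|·(|A x t|·|g t|)`.
Unit `b2b-balaban-gan24-formalise-leaf-05` (gen 44), G-an2-4 swarm leaf seat on road «BF-x» (NT lineage; first refusal T₆-ii, owner WORDS 16:15Z); `LEAVES-BFx.md` row (N-2) «T₆-ii» PART 1.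
-/

noncomputable section

namespace Summit.QuantumFields.BalabanUV.Beta.D1BFx.NeedleGhostBubble2PointwiseOpen

open Finset
open scoped BigOperators
open Literature.MathematicalPhysics.QuantumFieldTheory.Balaban1983to89
open Literature.MathematicalPhysics.QuantumFieldTheory.Balaban1983to89.Beta
open B6QGQLower276 (blk B mem_B)
open ExpKernelCalculus (Site MKer)
open Summit.QuantumFields.BalabanUV.Beta.D1BFx.PackedKernelSplit (biBubble)
open Summit.QuantumFields.BalabanUV.Beta.D1BFx.GhostStencilRooted (qJetAt qAntiAt)
open Summit.QuantumFields.BalabanUV.Beta.D1BFx.GhostNeedleRootedLetters (sum_B_const')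
open Summit.QuantumFields.BalabanUV.Beta.D1BFx.NeedleGhostBubble2Pointwise (biBubble_qAntiAt_qAntiAt)

variable (ρ : Site 4) (n : ℕ) (κ : Fin 4) (u : Site 4) (lam : Fin 4) (u' : Site 4) (A K : MKer 4 Unit)

/-- [folklore] **THE FOUR-PLACEMENT BOUND WITH THE MIXED CONTRACTIONS OPEN** (T₆-ii pointwise half): if `|Σ_{t∈B} A x t| ≤ RA` for `x ∈ B′`,
`|Σ_{t∈B′} K z t| ≤ RK` for `z ∈ B`, the COLUMN sums `|Σ_{x∈B′} A x t| ≤ CA` (`t ∈ B`), `|Σ_{z∈B} K z t| ≤ CK` (`t ∈ B′`), `RA ≥ 0`, then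
`|biBubble A (qAntiAt ρ n κ u) K (qAntiAt ρ n λ u′)| ≤ (RA·RK + CA·CK)·(Σ_{z∈B}|g z|)·(Σ_{x∈B′}|g′ x|) + n⁴·RA·Σ_{z∈B}Σ_{t∈B′}|g z|·(|K z t|·|g′ t|)
 + n⁴·RK·Σ_{x∈B′}Σ_{t∈B}|g′ x|·(|A x t|·|g t|)` — NO sup of either leg. -/
theorem abs_biBubble_qAntiAt_qAntiAt_le_open [NeZero n] {RA RK CA CK : ℝ} (hRA0 : 0 ≤ RA)
    (hRA : ∀ x ∈ B (n - 1) (blk (n - 1) u'), |∑ t ∈ B (n - 1) (blk (n - 1) u), A x t () ()| ≤ RA)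
    (hRK : ∀ z ∈ B (n - 1) (blk (n - 1) u), |∑ t ∈ B (n - 1) (blk (n - 1) u'), K z t () ()| ≤ RK)
    (hCA : ∀ t ∈ B (n - 1) (blk (n - 1) u), |∑ x ∈ B (n - 1) (blk (n - 1) u'), A x t () ()| ≤ CA)
    (hCK : ∀ t ∈ B (n - 1) (blk (n - 1) u'), |∑ z ∈ B (n - 1) (blk (n - 1) u), K z t () ()| ≤ CK) :
    |biBubble A (qAntiAt ρ n κ u) K (qAntiAt ρ n lam u')| ≤
      (RA * RK + CA * CK) *
          ((∑ z ∈ B (n - 1) (blk (n - 1) u), |qJetAt ρ n κ u (blk (n - 1) u) z|) *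
           (∑ x ∈ B (n - 1) (blk (n - 1) u'), |qJetAt ρ n lam u' (blk (n - 1) u') x|))
        + (n : ℝ) ^ 4 * RA * ∑ z ∈ B (n - 1) (blk (n - 1) u), ∑ t ∈ B (n - 1) (blk (n - 1) u'),
            |qJetAt ρ n κ u (blk (n - 1) u) z| * (|K z t () ()| * |qJetAt ρ n lam u' (blk (n - 1) u') t|)
        + (n : ℝ) ^ 4 * RK * ∑ x ∈ B (n - 1) (blk (n - 1) u'), ∑ t ∈ B (n - 1) (blk (n - 1) u),
            |qJetAt ρ n lam u' (blk (n - 1) u') x| * (|A x t () ()| * |qJetAt ρ n κ u (blk (n - 1) u) t|) := by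
  classical
  set Y := blk (n - 1) u with hY
  set Y' := blk (n - 1) u' with hY'
  set g : Site 4 → ℝ := fun t => qJetAt ρ n κ u Y t with hg
  set g' : Site 4 → ℝ := fun t => qJetAt ρ n lam u' Y' t with hg'
  set G₁ : ℝ := ∑ z ∈ B (n - 1) Y, |g z| with hG₁
  set G₁' : ℝ := ∑ x ∈ B (n - 1) Y', |g' x| with hG₁'
  set F₂ : ℝ := ∑ z ∈ B (n - 1) Y, ∑ t ∈ B (n - 1) Y', |g z| * (|K z t () ()| * |g' t|) with hF₂
  set F₃ : ℝ := ∑ x ∈ B (n - 1) Y', ∑ t ∈ B (n - 1) Y, |g' x| * (|A x t () ()| * |g t|) with hF₃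
  have hG0 : 0 ≤ G₁ := Finset.sum_nonneg fun _ _ => abs_nonneg _
  have hG0' : 0 ≤ G₁' := Finset.sum_nonneg fun _ _ => abs_nonneg _
  have hF₂0 : 0 ≤ F₂ := Finset.sum_nonneg fun _ _ => Finset.sum_nonneg fun _ _ => by positivity
  have hF₃0 : 0 ≤ F₃ := Finset.sum_nonneg fun _ _ => Finset.sum_nonneg fun _ _ => by positivity
  rw [biBubble_qAntiAt_qAntiAt]
  -- T1: `(Σ_{x∈B′} R x·g′ x)(Σ_{z∈B} g z·R′ z)`
  have hT1a : |∑ x ∈ B (n - 1) Y', (∑ t ∈ B (n - 1) Y, A x t () ()) * g' x| ≤ RA * G₁' := by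
    rw [hG₁', Finset.mul_sum]
    refine (Finset.abs_sum_le_sum_abs _ _).trans (Finset.sum_le_sum fun x hx => ?_)
    rw [abs_mul]; exact mul_le_mul_of_nonneg_right (hRA x hx) (abs_nonneg _)
  have hT1b : |∑ z ∈ B (n - 1) Y, g z * ∑ t ∈ B (n - 1) Y', K z t () ()| ≤ G₁ * RK := by
    rw [hG₁, Finset.sum_mul]
    refine (Finset.abs_sum_le_sum_abs _ _).trans (Finset.sum_le_sum fun z hz => ?_)
    rw [abs_mul]; exact mul_le_mul_of_nonneg_left (hRK z hz) (abs_nonneg _)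
  -- T2: `(Σ_{x∈B′} R x)(Σ_{z∈B} g z·ρ′ z)` with the contraction OPEN
  have hT2a : |∑ x ∈ B (n - 1) Y', ∑ t ∈ B (n - 1) Y, A x t () ()| ≤ (n : ℝ) ^ 4 * RA := by
    refine (Finset.abs_sum_le_sum_abs _ _).trans ?_
    calc ∑ x ∈ B (n - 1) Y', |∑ t ∈ B (n - 1) Y, A x t () ()| ≤ ∑ _x ∈ B (n - 1) Y', RA := Finset.sum_le_sum hRA
      _ = (n : ℝ) ^ 4 * RA := sum_B_const' n Y' RA
  have hT2b : |∑ z ∈ B (n - 1) Y, g z * ∑ t ∈ B (n - 1) Y', K z t () () * g' t| ≤ F₂ := by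
    rw [hF₂]
    refine (Finset.abs_sum_le_sum_abs _ _).trans (Finset.sum_le_sum fun z _ => ?_)
    rw [abs_mul, ← Finset.mul_sum]
    exact mul_le_mul_of_nonneg_left ((Finset.abs_sum_le_sum_abs _ _).trans (Finset.sum_le_sum fun t _ => (abs_mul _ _).le)) (abs_nonneg _)
  -- T3: `(Σ_{x∈B′} ρ x·g′ x)(Σ_{z∈B} R′ z)` with the contraction OPEN
  have hT3a : |∑ x ∈ B (n - 1) Y', (∑ t ∈ B (n - 1) Y, A x t () () * g t) * g' x| ≤ F₃ := by
    rw [hF₃]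
    refine (Finset.abs_sum_le_sum_abs _ _).trans (Finset.sum_le_sum fun x _ => ?_)
    rw [abs_mul, mul_comm, ← Finset.mul_sum]
    exact mul_le_mul_of_nonneg_left ((Finset.abs_sum_le_sum_abs _ _).trans (Finset.sum_le_sum fun t _ => (abs_mul _ _).le)) (abs_nonneg _)
  have hT3b : |∑ z ∈ B (n - 1) Y, ∑ t ∈ B (n - 1) Y', K z t () ()| ≤ (n : ℝ) ^ 4 * RK := by
    refine (Finset.abs_sum_le_sum_abs _ _).trans ?_
    calc ∑ z ∈ B (n - 1) Y, |∑ t ∈ B (n - 1) Y', K z t () ()| ≤ ∑ _z ∈ B (n - 1) Y, RK := Finset.sum_le_sum hRK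
      _ = (n : ℝ) ^ 4 * RK := sum_B_const' n Y RK
  -- T4: the SIGNED sums through the column sums
  have hT4a : |∑ x ∈ B (n - 1) Y', ∑ t ∈ B (n - 1) Y, A x t () () * g t| ≤ CA * G₁ := by
    rw [Finset.sum_comm]
    have e : ∀ t ∈ B (n - 1) Y, ∑ x ∈ B (n - 1) Y', A x t () () * g t = (∑ x ∈ B (n - 1) Y', A x t () ()) * g t := fun t _ => by
      rw [Finset.sum_mul]
    rw [Finset.sum_congr rfl e, hG₁, Finset.mul_sum]
    refine (Finset.abs_sum_le_sum_abs _ _).trans (Finset.sum_le_sum fun t ht => ?_)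
    rw [abs_mul]; exact mul_le_mul_of_nonneg_right (hCA t ht) (abs_nonneg _)
  have hT4b : |∑ z ∈ B (n - 1) Y, ∑ t ∈ B (n - 1) Y', K z t () () * g' t| ≤ CK * G₁' := by
    rw [Finset.sum_comm]
    have e : ∀ t ∈ B (n - 1) Y', ∑ z ∈ B (n - 1) Y, K z t () () * g' t = (∑ z ∈ B (n - 1) Y, K z t () ()) * g' t := fun t _ => by
      rw [Finset.sum_mul]
    rw [Finset.sum_congr rfl e, hG₁', Finset.mul_sum]
    refine (Finset.abs_sum_le_sum_abs _ _).trans (Finset.sum_le_sum fun t ht => ?_)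
    rw [abs_mul]; exact mul_le_mul_of_nonneg_right (hCK t ht) (abs_nonneg _)
  -- assemble
  have hCA0 : 0 ≤ CA := (abs_nonneg _).trans (hCA u (mem_B.2 rfl))
  have h4 : ∀ p q r s : ℝ, |p - q - r + s| ≤ |p| + |q| + |r| + |s| := fun p q r s => by
    have h1 := abs_add_le (p - q - r) s; have h2 := abs_sub (p - q) r; have h3 := abs_sub p q; linarith
  refine (h4 _ _ _ _).trans ?_
  rw [abs_mul, abs_mul, abs_mul, abs_mul]
  have hn4 : (0 : ℝ) ≤ (n : ℝ) ^ 4 := pow_nonneg (Nat.cast_nonneg n) 4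
  calc |∑ x ∈ B (n - 1) Y', (∑ t ∈ B (n - 1) Y, A x t () ()) * g' x| * |∑ z ∈ B (n - 1) Y, g z * ∑ t ∈ B (n - 1) Y', K z t () ()|
        + |∑ x ∈ B (n - 1) Y', ∑ t ∈ B (n - 1) Y, A x t () ()| * |∑ z ∈ B (n - 1) Y, g z * ∑ t ∈ B (n - 1) Y', K z t () () * g' t|
        + |∑ x ∈ B (n - 1) Y', (∑ t ∈ B (n - 1) Y, A x t () () * g t) * g' x| * |∑ z ∈ B (n - 1) Y, ∑ t ∈ B (n - 1) Y', K z t () ()|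
        + |∑ x ∈ B (n - 1) Y', ∑ t ∈ B (n - 1) Y, A x t () () * g t| * |∑ z ∈ B (n - 1) Y, ∑ t ∈ B (n - 1) Y', K z t () () * g' t|
      ≤ (RA * G₁') * (G₁ * RK) + ((n : ℝ) ^ 4 * RA) * F₂ + F₃ * ((n : ℝ) ^ 4 * RK) + (CA * G₁) * (CK * G₁') :=
        add_le_add (add_le_add (add_le_add
          (mul_le_mul hT1a hT1b (abs_nonneg _) (mul_nonneg hRA0 hG0'))
          (mul_le_mul hT2a hT2b (abs_nonneg _) (mul_nonneg hn4 hRA0)))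
          (mul_le_mul hT3a hT3b (abs_nonneg _) hF₃0))
          (mul_le_mul hT4a hT4b (abs_nonneg _) (mul_nonneg hCA0 hG0))
    _ = (RA * RK + CA * CK) * (G₁ * G₁') + (n : ℝ) ^ 4 * RA * F₂ + (n : ℝ) ^ 4 * RK * F₃ := by ring

end Summit.QuantumFields.BalabanUV.Beta.D1BFx.NeedleGhostBubble2PointwiseOpen

end
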